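import Literature.IUT.HodgeArakelov.BadPrimeGaussianMonoidsCohomologyModelProofs
import Literature.IUT.HodgeArakelov.BadPrimeGaussianMonoidsSyncMonoidProofs
import Literature.IUT.HodgeArakelov.BadPrimeGaussianMonoidsSyncInftyTorsionProofs
import Literature.IUT.HodgeArakelov.CohomologyLimitComap

/-!
# [IUTchII] Cor 3.5 (ii) "⥤": BOTH junction hypotheses `hr` (equivariance of restriction) and `hfix` DISCHARGED
# at the continuous-cohomology model — restriction to the decomposition groups `D^δ_{t,μ_-}` as the PULL-BACK of
# `lim_K H¹(Π_Ÿ|_K, −)` along the evaluation section (proof-only sequel to `…CohomologyModelProofs.lean`)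

S. Mochizuki, *Inter-universal Teichmüller theory II*, kurims Dec-2020 manuscript, Cor 3.5 (ii) p. 95: "the
restriction operations described in detail in Corollary 2.8, (i), (ii), determine a collection of compatible
morphisms … `{G_v(M^Θ_*▶)_{|t|}}_{|t| ∈ F_l^⋇} ↷ ∞Ψ^ι_env(M^Θ_*) ⥲ ∞Ψ_ξ(M^Θ_*) ⊇ Ψ^ι_env(M^Θ_*) ⥲ Ψ_ξ(M^Θ_*)` … where
`↞` denotes the compatibility of the action of `G_v(M^Θ_*▶)_{|t|}` on the factor labeled `|t|` … with the
inclusions `G_v(M^Θ_*) ↪ Π_{v▶}(M^Θ_*▶)` determined by the various choices of the `D^δ_{t,μ_-}`"; Cor 2.4 (ii)(c)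
p. 70 ("`D^δ_{t,μ_-}` … the image of an evaluation section"); Cor 3.5 (i) p. 94 ("well-defined up to composition
with an inner automorphism … independent of `|t|`"); Rmk 3.6.1 p. 101 [cite: Mochizuki2012, Cor 3.5 (ii) p.95].
Claim key DISPUTED (D-0012). PROOF-ONLY companion (abc-iut cell, layer L6, seat abc-iut-w4-d004 gen 2;
DISCHARGE-L6 §F row F1 continuation, node **IUTchII:Cor3.5(ii)** Galois clause, sub-DAG row Cor-35.ii.r10).
NO definition, NO `Prop` fact.

THE MODEL (over the landed `CohomologySystemOfContH1` / `CohomologyLimitConj` / `CohomologyLimitComap`):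
`Π` a topological group with `Π_Ÿ = N ⊴ Π`; the ambient module `lim_K H¹(N ⊓ K, A)` (`h1Lim φ A N ⊥`) with its
conjugation action `h1LimConj`; the decomposition group `G_v ≅ D^δ_{t₀,μ_-}` as ITS OWN topological group `Π₀`
with a continuous homomorphism `ι : Π₀ → Π` landing in `N` (the evaluation section of Cor 2.4 (ii)(c)); the
copy labelled `t` reached through the symmetrizing element `γ_t ∈ Π` (Cor 3.5 (i)): section
`s_t = γ_t · ι(−) · γ_t⁻¹`, restriction `r_t = ι^* ∘ conj(γ_t⁻¹) : lim_K H¹(N ⊓ K, A) → lim_{K₀} H¹(Π₀ ⊓ K₀, A)`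
(`h1LimComap ∘ h1LimConj γ_t⁻¹`) into the cohomology OF `G_v` with its own conjugation action
`β = h1LimConjMulAut (φ ∘ ι)` (the labeled `G_v`-action).
* `h1LimComap_conj_conjugate` — **`hr` at the model**: `r_t (conj (γ_t ι(g) γ_t⁻¹) y) = β_g (r_t y)` (action laws +
  abc-iut-w4-d004 `h1LimComap_conj`, i.e. L2 `ContH1.comap_conj`);
* `conjugate_section_mem` — `γ_t ι(g) γ_t⁻¹ ∈ N` (so `hfix` of `…CohomologyModelProofs` applies);
* `restriction_conj_section_eq`, `conj_section_eq_self_ofModel` — TRANSPORT of `hr`, `hfix` to any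
  `ThetaEnvData E` identified with the model (`ψ : E.H ≃ lim` equivariant along `j : Π_X(M^Θ_*) → Π`, the datum
  of `TemperedThetaMonoidsModelProofs`-type), for restriction morphisms `R_t : E.H → Multiplicative lim₀`
  PINNED to `ι^* ∘ conj(γ_t⁻¹) ∘ ψ`;
* `sections_mk_eq_of_aug` — the hypothesis `hs` (sections agree modulo `Δ`; Cor 3.5 (i) "independent of `|t|`")
  DERIVED when an augmentation `a : Π → G_v` with `Ker(a ∘ j) ≤ Δ` kills the symmetrizing elements `γ_t`;
* `mrange_pi_diagonalStable'_ofCohomologyModel` (restrictions out of the theta monoid — the typing of record,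
  abc-iut-w5-d100 `mrange_pi_diagonalStable'_of_kummer_of_fixed`), `map_pi_diagonalStable_ofCohomologyModel`
  (restrictions out of the ambient group, abc-iut-w4-d004 `map_pi_diagonalStable_of_kummer_of_fixed`) and
  `restrictionIso'_equivariant_ofCohomologyModel` (Rmk 3.6.1, iso of record): **"each `Ψ_ξ(M^Θ_*)` is equipped
  with a natural action by `G_v(M^Θ_*▶)_{⟨F_l^⋇⟩}`" with `hr` AND `hfix` DISCHARGED.** Residual named hypotheses,
  all DATA/identifications: the Kummer data of Prop 3.1 (ii) (GAP-LEDGER G-w4d019-1, narrowed to the coefficient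
  isomorphism), the sections agreeing modulo `Δ` (`hs`; automatic for genuine sections of `Π_X ↠ G_v`), the
  model identification `(j, ψ)`, the presentation `j ∘ s_t = γ_t ι γ_t⁻¹` of the sections, `ι(Π₀) ≤ Π_Ÿ`, and
  `θ` a top-level class; `mrange_pi_diagonalStable'_ofCohomologyModel_of_aug` replaces `hs` by the
  augmentation datum — NO junction hypothesis of the Galois clause remains (all residuals are identifications);
* `pi_restriction_inftyThetaMonoid_upToTorsion_ofCohomologyModel` — the `∞`-level (Rmk 3.6.1 "involving the
  monoids `∞Ψ`") in abc-iut-w5-d131's faithful torsion form (`…SyncInftyTorsionProofs`), `hr`/`hfix`/`hs`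
  discharged likewise (residual: Kummer data, identifications, `hroots`, `htors`).

Nothing here asserts a disputed claim or takes a side on [IUTchIII] Cor 3.12; typed ≠ proved ≠ endorsed.
-/

namespace Literature.IUT.HodgeArakelov

namespace BadPrimeGaussianMonoids

open Literature.AnabelianGeometry.EtaleTheta CohomologySystemOfContH1 TemperedThetaMonoids

universe u v w x

/-! ### 1. `hr` at the model: pull-back along a conjugate of the evaluation section -/

section Model

variable {P₀ P : TopGroup.{x}} {G' : Type x} [Group G'] [TopologicalSpace G'] [IsTopologicalGroup G']
  (φ : P →* G') (A : Subgroup G') [A.Normal] [IsMulCommutative A] (N : Subgroup P) [N.Normal]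
  (ι : P₀ →* P) (hι : Continuous ι)

/-- **IUTchII:Cor3.5(ii)** `hr` AT THE MODEL: for the restriction `r_t := ι^* ∘ conj(γ_t⁻¹)` to the decomposition
group labelled `t` (`D_t = γ_t ι(Π₀) γ_t⁻¹`, pulled back to the cohomology of `Π₀ ≅ G_v` itself) and the section
`s_t(g) = γ_t ι(g) γ_t⁻¹`: `r_t (conj (s_t g) y) = conj_g (r_t y)` — the labeled `G_v`-action on the factor `t`.
[cite: Mochizuki2012, Cor 3.5 (ii) p.95] -/
theorem h1LimComap_conj_conjugate (hH : (⊤ : Subgroup P₀).map ι ≤ N) (γ : P) (g : P₀) (y : h1Lim φ A N ⊥) :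
    h1LimComap φ A ι hι hH (h1LimConj φ A N γ⁻¹ (h1LimConj φ A N (γ * ι g * γ⁻¹) y)) =
      h1LimConj (φ.comp ι) A ⊤ g (h1LimComap φ A ι hι hH (h1LimConj φ A N γ⁻¹ y)) := by
  rw [← h1LimConj_mul_apply, show γ⁻¹ * (γ * ι g * γ⁻¹) = ι g * γ⁻¹ by group, h1LimConj_mul_apply,
    h1LimComap_conj]

omit [N.Normal] in
/-- The conjugated sections land in `N = Π_Ÿ` (`ι(Π₀) ≤ N`, `N ⊴ Π`): the membership `s_t(g) ∈ Π_Ÿ` behind `hfix`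
(Cor 2.4 (ii)(c)). [cite: Mochizuki2012, Cor 2.4 (ii) p.70] -/
theorem conjugate_section_mem [hN : N.Normal] (hH : (⊤ : Subgroup P₀).map ι ≤ N) (γ : P) (g : P₀) :
    γ * ι g * γ⁻¹ ∈ N :=
  hN.conj_mem (ι g) (hH ⟨g, Subgroup.mem_top g, rfl⟩) γ

end Model

/-! ### 2. Transport to a `ThetaEnvData` identified with the model -/

section Transport

variable {Q : Type u} [Group Q] (E : TemperedThetaMonoids.ThetaEnvData.{u, v} Q)
  {P₀ P : TopGroup.{x}} {G' : Type x} [Group G'] [TopologicalSpace G'] [IsTopologicalGroup G']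
  (φ : P →* G') (A : Subgroup G') [A.Normal] [IsMulCommutative A] (N : Subgroup P) [N.Normal]
  (ι : P₀ →* P) (hι : Continuous ι)
  (j : Q →* P) (ψ : Additive E.H ≃+ h1Lim φ A N ⊥) {T : Type*} (γ : T → P) (s : T → (P₀ →* Q))

/-- **IUTchII:Cor3.5(ii)** `hr` DERIVED for a `ThetaEnvData` identified with the model: restriction morphisms
`R_t : E.H → lim_{K₀} H¹(Π₀ ⊓ K₀, A)` pinned to `ι^* ∘ conj(γ_t⁻¹) ∘ ψ` are equivariant along the sections
`s_t` (presented as `j ∘ s_t = γ_t ι γ_t⁻¹`) for the labeled `G_v`-action `h1LimConjMulAut (φ ∘ ι)`.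
[cite: Mochizuki2012, Cor 3.5 (ii) p.95] -/
theorem restriction_conj_section_eq (hH : (⊤ : Subgroup P₀).map ι ≤ N)
    (hψ : ∀ (p : Q) (y : E.H), ψ (Additive.ofMul (E.conj p y)) = h1LimConj φ A N (j p) (ψ (Additive.ofMul y)))
    (hjs : ∀ t g, j (s t g) = γ t * ι g * (γ t)⁻¹)
    (R : T → (E.H →* Multiplicative (h1Lim (φ.comp ι) A (⊤ : Subgroup P₀) ⊥)))
    (hR : ∀ t y, Multiplicative.toAdd (R t y) =
      h1LimComap φ A ι hι hH (h1LimConj φ A N (γ t)⁻¹ (ψ (Additive.ofMul y))))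
    (t : T) (g : P₀) (y : E.H) :
    R t (E.conj (s t g) y) = h1LimConjMulAut (φ.comp ι) A ⊤ g (R t y) := by
  apply Multiplicative.toAdd.injective
  rw [h1LimConjMulAut_apply, toAdd_ofAdd, hR, hR, hψ, hjs]
  exact h1LimComap_conj_conjugate φ A N ι hι hH (γ t) g _

/-- **IUTchII:Cor3.5(ii)** `hfix` for sections presented as conjugates of the evaluation section: they land in
`Π_Ÿ`, so abc-iut-w4-d004's `conj_section_eq_self_ofTopClass` applies — `E.conj (s t g) θ = θ` for every
top-level class `θ`. [cite: Mochizuki2012, Cor 3.5 (ii) p.95] -/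
theorem conj_section_eq_self_ofModel (hH : (⊤ : Subgroup P₀).map ι ≤ N)
    (hψ : ∀ (p : Q) (y : E.H), ψ (Additive.ofMul (E.conj p y)) = h1LimConj φ A N (j p) (ψ (Additive.ofMul y)))
    (hjs : ∀ t g, j (s t g) = γ t * ι g * (γ t)⁻¹) {θ : E.H}
    (hθ : ψ (Additive.ofMul θ) ∈ Set.range ((cohomologySystemOfContH1 φ A N).toLim ⊤)) :
    ∀ g t, E.conj (s t g) θ = θ :=
  conj_section_eq_self_ofTopClass E φ A N j ψ hψ s
    (fun t g => by rw [hjs]; exact conjugate_section_mem N ι hH (γ t) g) hθ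

/-- **IUTchII:Cor3.5(i)** (kurims p.94: "this inner automorphism indeterminacy … is, in fact, independent of
`|t|`") — the hypothesis `hs` ("the sections agree modulo `Δ`") DERIVED for sections presented as conjugates
`γ_t ι γ_t⁻¹` of one evaluation section by elements `γ_t` of the GEOMETRIC group: if an augmentation
`a : Π → G_v` kills the `γ_t` (`γ_t ∈ Δ̂^±_v`, Cor 2.4 (ii)/(iii)) and `a ∘ j` vanishes only on `Δ`, then
`s_t(g) ≡ s_{t'}(g) mod Δ`. [cite: Mochizuki2012, Cor 3.5 (i) p.94] -/
theorem sections_mk_eq_of_aug {K : Type*} [Group K] (a : P →* K) (Δ : Subgroup Q) [Δ.Normal]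
    (hΔ : ∀ x : Q, a (j x) = 1 → x ∈ Δ) (hγ : ∀ t, a (γ t) = 1)
    (hjs : ∀ t g, j (s t g) = γ t * ι g * (γ t)⁻¹) (t t' : T) (g : P₀) :
    (QuotientGroup.mk (s t g) : Q ⧸ Δ) = QuotientGroup.mk (s t' g) := by
  rw [QuotientGroup.eq]
  apply hΔ
  rw [map_mul, map_inv, hjs, hjs]
  simp [hγ]

end Transport

/-! ### 3. The Galois clause with `hr` and `hfix` discharged -/

section Assembly

variable {S : ThetaSetting.{u}} (A : AbsTopMonoids S) (Pc : IsoClass S.PiX)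
  (E : TemperedThetaMonoids.ThetaEnvData.{u, v} Pc.G) (κ : A.MTM Pc →* E.H) {T : Type*}
  {P₀ P : TopGroup.{x}} {G' : Type x} [Group G'] [TopologicalSpace G'] [IsTopologicalGroup G']
  (φ : P →* G') (Am : Subgroup G') [Am.Normal] [IsMulCommutative Am] (N : Subgroup P) [N.Normal]
  (ι : P₀ →* P) (hι : Continuous ι) (hH : (⊤ : Subgroup P₀).map ι ≤ N)
  (j : Pc.G →* P) (ψ : Additive E.H ≃+ h1Lim φ Am N ⊥) (γ : T → P) (s : T → (P₀ →* Pc.G))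

/-- **IUTchII:Cor3.5(ii)** (kurims p.95) "each `Ψ_ξ(M^Θ_*)` is equipped with a natural action by
`G_v(M^Θ_*▶)_{⟨F_l^⋇⟩}`" — restrictions OUT OF THE THETA MONOID `Ψ^ι_env = M^×_TM · θ^ℕ` (the typing of record),
**with `hr` and `hfix` DISCHARGED at the cohomology model**: the Gaussian monoid `Ψ_ξ = r(Ψ^ι_env)` is stable
under the diagonal `G_v,⟨F_l^⋇⟩`-action. Hypotheses: (a) Kummer data of Prop 3.1 (ii) (G-w4d019-1), (b) sections
agreeing modulo `Δ`, (c) model identification `(j, ψ)`, (d) `j ∘ s_t = γ_t ι γ_t⁻¹` with `ι(Π₀) ≤ Π_Ÿ`,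
(e) `θ` top-level, (f) the restrictions pinned to `ι^* ∘ conj(γ_t⁻¹) ∘ ψ`.
[cite: Mochizuki2012, Cor 3.5 (ii) p.95] -/
theorem mrange_pi_diagonalStable'_ofCohomologyModel (hκ : Function.Injective κ)
    (hcns : E.constantMonoid = MonoidHom.mrange κ)
    (hκeq : ∀ (x : Pc.G) (m : A.MTM Pc), κ (A.actMTM Pc x m) = E.conj x (κ m))
    (hs : ∀ t t' g, (QuotientGroup.mk (s t g) : Pc.G ⧸ A.Delta Pc) = QuotientGroup.mk (s t' g))
    (hψ : ∀ (p : Pc.G) (y : E.H),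
      ψ (Additive.ofMul (E.conj p y)) = h1LimConj φ Am N (j p) (ψ (Additive.ofMul y)))
    (hjs : ∀ t g, j (s t g) = γ t * ι g * (γ t)⁻¹) (θ : E.H)
    (hθ : ψ (Additive.ofMul θ) ∈ Set.range ((cohomologySystemOfContH1 φ Am N).toLim ⊤))
    (R : T → (E.H →* Multiplicative (h1Lim (φ.comp ι) Am (⊤ : Subgroup P₀) ⊥)))
    (hR : ∀ t y, Multiplicative.toAdd (R t y) =
      h1LimComap φ Am ι hι hH (h1LimConj φ Am N (γ t)⁻¹ (ψ (Additive.ofMul y)))) (t₀ : T) (g : P₀) :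
    (MonoidHom.mrange (MonoidHom.pi fun t =>
        (R t).comp (splitMonoid E.units (Submonoid.powers θ)).subtype)).map
        (piIso T (h1LimConjMulAut (φ.comp ι) Am ⊤ g)).toMonoidHom =
      MonoidHom.mrange (MonoidHom.pi fun t => (R t).comp (splitMonoid E.units (Submonoid.powers θ)).subtype) :=
  mrange_pi_diagonalStable'_of_kummer_of_fixed A Pc E κ hκ hcns hκeq s hs (h1LimConjMulAut (φ.comp ι) Am ⊤) θ
    (conj_section_eq_self_ofModel E φ Am N ι j ψ γ s hH hψ hjs hθ) _
    (fun t g' x => restriction_conj_section_eq E φ Am N ι hι j ψ γ s hH hψ hjs R hR t g' (x : E.H)) t₀ g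

/-- **IUTchII:Cor3.5(ii)** (kurims p.95), the same for restrictions typed out of the ambient group `E.H`
(abc-iut-w4-d004 `map_pi_diagonalStable_of_kummer_of_fixed`), `hr` and `hfix` DISCHARGED at the cohomology
model. [cite: Mochizuki2012, Cor 3.5 (ii) p.95] -/
theorem map_pi_diagonalStable_ofCohomologyModel (hκ : Function.Injective κ)
    (hcns : E.constantMonoid = MonoidHom.mrange κ)
    (hκeq : ∀ (x : Pc.G) (m : A.MTM Pc), κ (A.actMTM Pc x m) = E.conj x (κ m))
    (hs : ∀ t t' g, (QuotientGroup.mk (s t g) : Pc.G ⧸ A.Delta Pc) = QuotientGroup.mk (s t' g))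
    (hψ : ∀ (p : Pc.G) (y : E.H),
      ψ (Additive.ofMul (E.conj p y)) = h1LimConj φ Am N (j p) (ψ (Additive.ofMul y)))
    (hjs : ∀ t g, j (s t g) = γ t * ι g * (γ t)⁻¹) (θ : E.H)
    (hθ : ψ (Additive.ofMul θ) ∈ Set.range ((cohomologySystemOfContH1 φ Am N).toLim ⊤))
    (R : T → (E.H →* Multiplicative (h1Lim (φ.comp ι) Am (⊤ : Subgroup P₀) ⊥)))
    (hR : ∀ t y, Multiplicative.toAdd (R t y) =
      h1LimComap φ Am ι hι hH (h1LimConj φ Am N (γ t)⁻¹ (ψ (Additive.ofMul y)))) (t₀ : T) (g : P₀) :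
    ((splitMonoid E.units (Submonoid.powers θ)).map (MonoidHom.pi R)).map
        (piIso T (h1LimConjMulAut (φ.comp ι) Am ⊤ g)).toMonoidHom =
      (splitMonoid E.units (Submonoid.powers θ)).map (MonoidHom.pi R) :=
  map_pi_diagonalStable_of_kummer_of_fixed A Pc E κ hκ hcns hκeq s hs (h1LimConjMulAut (φ.comp ι) Am ⊤) R
    (fun t g' y => restriction_conj_section_eq E φ Am N ι hι j ψ γ s hH hψ hjs R hR t g' y) θ
    (conj_section_eq_self_ofModel E φ Am N ι j ψ γ s hH hψ hjs hθ) t₀ g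

/-- **IUTchII:Rmk3.6.1** (kurims p.101) Galois functoriality of the restriction ISOMORPHISM of record (any
`e : M^×_TM · θ^ℕ ⥲ Ψ_ξ` pinned to the restriction, `exists_restrictionIso'`), `hr` and `hfix` DISCHARGED at the
cohomology model. [cite: Mochizuki2012, Rmk 3.6.1 p.101] -/
theorem restrictionIso'_equivariant_ofCohomologyModel (hκ : Function.Injective κ)
    (hcns : E.constantMonoid = MonoidHom.mrange κ)
    (hκeq : ∀ (x : Pc.G) (m : A.MTM Pc), κ (A.actMTM Pc x m) = E.conj x (κ m))
    (hs : ∀ t t' g, (QuotientGroup.mk (s t g) : Pc.G ⧸ A.Delta Pc) = QuotientGroup.mk (s t' g))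
    (hψ : ∀ (p : Pc.G) (y : E.H),
      ψ (Additive.ofMul (E.conj p y)) = h1LimConj φ Am N (j p) (ψ (Additive.ofMul y)))
    (hjs : ∀ t g, j (s t g) = γ t * ι g * (γ t)⁻¹) (θ : E.H)
    (hθ : ψ (Additive.ofMul θ) ∈ Set.range ((cohomologySystemOfContH1 φ Am N).toLim ⊤))
    (R : T → (E.H →* Multiplicative (h1Lim (φ.comp ι) Am (⊤ : Subgroup P₀) ⊥)))
    (hR : ∀ t y, Multiplicative.toAdd (R t y) =
      h1LimComap φ Am ι hι hH (h1LimConj φ Am N (γ t)⁻¹ (ψ (Additive.ofMul y))))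
    {S' : Submonoid (T → Multiplicative (h1Lim (φ.comp ι) Am (⊤ : Subgroup P₀) ⊥))}
    (e : splitMonoid E.units (Submonoid.powers θ) ≃* S')
    (he : ∀ x, ((e x : S') : T → _) =
      MonoidHom.pi (fun t => (R t).comp (splitMonoid E.units (Submonoid.powers θ)).subtype) x)
    (t₀ : T) (g : P₀) (x : splitMonoid E.units (Submonoid.powers θ)) :
    ((e ⟨E.conj (s t₀ g) x, thetaSplit_conjStable_of_kummer A Pc E κ hcns hκeq s θ
        (theta_orbit_of_fixed Pc E s θ
          (conj_section_eq_self_ofModel E φ Am N ι j ψ γ s hH hψ hjs hθ)).2 g t₀ x x.2⟩ : S') : T → _) =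
      piIso T (h1LimConjMulAut (φ.comp ι) Am ⊤ g) (e x : T → _) :=
  restrictionIso'_equivariant_of_kummer_of_fixed A Pc E κ hκ hcns hκeq s hs (h1LimConjMulAut (φ.comp ι) Am ⊤) θ
    (conj_section_eq_self_ofModel E φ Am N ι j ψ γ s hH hψ hjs hθ) _
    (fun t g' y => restriction_conj_section_eq E φ Am N ι hι j ψ γ s hH hψ hjs R hR t g' (y : E.H)) e he t₀ g x

/-- **IUTchII:Cor3.5(ii)** (kurims p.95), the headline form with `hs` ALSO discharged (`sections_mk_eq_of_aug`):
"each `Ψ_ξ(M^Θ_*)` is equipped with a natural action by `G_v(M^Θ_*▶)_{⟨F_l^⋇⟩}`" for the restrictions out of the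
theta monoid, at the cohomology model, from: the Kummer data of Prop 3.1 (ii) (G-w4d019-1); the model
identification `(j, ψ)`; an augmentation `a : Π → G_v` with `Ker(a ∘ j) ≤ Δ` killing the symmetrizing elements
`γ_t`; the presentation `j ∘ s_t = γ_t ι γ_t⁻¹` with `ι(Π₀) ≤ Π_Ÿ`; `θ` top-level; restrictions pinned to
`ι^* ∘ conj(γ_t⁻¹) ∘ ψ`. No junction hypothesis of the Galois clause remains (hsync-constants, hstab, hr, hfix,
hs all DERIVED). [cite: Mochizuki2012, Cor 3.5 (ii) p.95] -/
theorem mrange_pi_diagonalStable'_ofCohomologyModel_of_aug (hκ : Function.Injective κ)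
    (hcns : E.constantMonoid = MonoidHom.mrange κ)
    (hκeq : ∀ (x : Pc.G) (m : A.MTM Pc), κ (A.actMTM Pc x m) = E.conj x (κ m))
    {K : Type*} [Group K] (a : P →* K) (hΔ : ∀ x : Pc.G, a (j x) = 1 → x ∈ A.Delta Pc)
    (hγ : ∀ t, a (γ t) = 1)
    (hψ : ∀ (p : Pc.G) (y : E.H),
      ψ (Additive.ofMul (E.conj p y)) = h1LimConj φ Am N (j p) (ψ (Additive.ofMul y)))
    (hjs : ∀ t g, j (s t g) = γ t * ι g * (γ t)⁻¹) (θ : E.H)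
    (hθ : ψ (Additive.ofMul θ) ∈ Set.range ((cohomologySystemOfContH1 φ Am N).toLim ⊤))
    (R : T → (E.H →* Multiplicative (h1Lim (φ.comp ι) Am (⊤ : Subgroup P₀) ⊥)))
    (hR : ∀ t y, Multiplicative.toAdd (R t y) =
      h1LimComap φ Am ι hι hH (h1LimConj φ Am N (γ t)⁻¹ (ψ (Additive.ofMul y)))) (t₀ : T) (g : P₀) :
    (MonoidHom.mrange (MonoidHom.pi fun t =>
        (R t).comp (splitMonoid E.units (Submonoid.powers θ)).subtype)).map
        (piIso T (h1LimConjMulAut (φ.comp ι) Am ⊤ g)).toMonoidHom =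
      MonoidHom.mrange (MonoidHom.pi fun t => (R t).comp (splitMonoid E.units (Submonoid.powers θ)).subtype) :=
  mrange_pi_diagonalStable'_ofCohomologyModel A Pc E κ φ Am N ι hι hH j ψ γ s hκ hcns hκeq
    (sections_mk_eq_of_aug ι j γ s a (A.Delta Pc) hΔ hγ hjs) hψ hjs θ hθ R hR t₀ g

/-! ### 4. The `∞`-level (Remark 3.6.1 "involving the monoids `∞Ψ`"), faithful torsion form -/

/-- **IUTchII:Cor3.5(ii)** / **IUTchII:Rmk3.6.1** at the `∞`-level (kurims p. 95 "up to multiplication by an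
element of the `N`-torsion subgroup"; p. 101 "involving the monoids `∞Ψ`"), abc-iut-w5-d131's FAITHFUL torsion
form `pi_restriction_inftyThetaMonoid_upToTorsion_of_kummer_of_fixed` with its junction hypotheses `hr`, `hfix`
AND `hs` DISCHARGED at the cohomology model: on `∞Ψ^ι_env` the product restriction intertwines the action through
`s_{t₀}` with the diagonal labeled `G_v`-action UP TO a family of torsion units. Residual named hypotheses: the
Kummer data (G-w4d019-1), the augmentation/identification data `(a, j, ψ, γ, ι)`, `θ` top-level, and print's
`hroots` (Prop 1.4 p. 27) / `htors` (`M^μ_TM ⊆ M^×_TM`). [cite: Mochizuki2012, Rmk 3.6.1 p.101] -/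
theorem pi_restriction_inftyThetaMonoid_upToTorsion_ofCohomologyModel (hκ : Function.Injective κ)
    (hcns : E.constantMonoid = MonoidHom.mrange κ)
    (hκeq : ∀ (x : Pc.G) (m : A.MTM Pc), κ (A.actMTM Pc x m) = E.conj x (κ m))
    {K : Type*} [Group K] (a : P →* K) (hΔ : ∀ x : Pc.G, a (j x) = 1 → x ∈ A.Delta Pc)
    (hγ : ∀ t, a (γ t) = 1)
    (hψ : ∀ (p : Pc.G) (y : E.H),
      ψ (Additive.ofMul (E.conj p y)) = h1LimConj φ Am N (j p) (ψ (Additive.ofMul y)))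
    (hjs : ∀ t g, j (s t g) = γ t * ι g * (γ t)⁻¹) (i₀ : E.Iota) (θ : E.H)
    (hθ : ψ (Additive.ofMul θ) ∈ Set.range ((cohomologySystemOfContH1 φ Am N).toLim ⊤))
    (hroots : ∀ ϑ ∈ E.inftyThetaEnv i₀, ∃ n : ℕ, 0 < n ∧ ϑ ^ n ∈ splitMonoid E.units (Submonoid.powers θ))
    (htors : ∀ u : E.H, IsOfFinOrder u → u ∈ E.units)
    (R : T → (E.H →* Multiplicative (h1Lim (φ.comp ι) Am (⊤ : Subgroup P₀) ⊥)))
    (hR : ∀ t y, Multiplicative.toAdd (R t y) =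
      h1LimComap φ Am ι hι hH (h1LimConj φ Am N (γ t)⁻¹ (ψ (Additive.ofMul y))))
    (t₀ : T) (g : P₀) (x : E.H) (hx : x ∈ E.inftyThetaMonoid i₀) :
    ∃ u : T → E.H, (∀ t, u t ∈ E.units ∧ IsOfFinOrder (u t)) ∧
      MonoidHom.pi R (E.conj (s t₀ g) x) =
        (fun t => R t (u t)) * piIso T (h1LimConjMulAut (φ.comp ι) Am ⊤ g) (MonoidHom.pi R x) :=
  pi_restriction_inftyThetaMonoid_upToTorsion_of_kummer_of_fixed A Pc E κ hκ hcns hκeq s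
    (sections_mk_eq_of_aug ι j γ s a (A.Delta Pc) hΔ hγ hjs) (h1LimConjMulAut (φ.comp ι) Am ⊤) R
    (fun t g' y => restriction_conj_section_eq E φ Am N ι hι j ψ γ s hH hψ hjs R hR t g' y) i₀ θ
    (conj_section_eq_self_ofModel E φ Am N ι j ψ γ s hH hψ hjs hθ) hroots htors t₀ g x hx

end Assembly

end BadPrimeGaussianMonoids

end Literature.IUT.HodgeArakelov
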